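import Mathlib
import HarnessLib
import Summits.CriticalPhenomena.SAWScalingLimit.Theses.SAWTotalPositivity

/-!
# Sketch — first lemmas for crux ideas on `TPToTraversalBound` (stmt-CriticalPhenomena-10687)

Folder-local sketch (crux-ideate round 1, ideator 2). Everything is a `Prop`; nothing is proved.
Decls:
* `PrefixSet`            — the event "the chord extends the prefix η" (typed as in
                           `SAW.condExcursionAvoidance`).
* `OptionalStoppingLR`   — the optional-stopping / disjoint-prefix inequality behind the
                           target-switching martingale (provable now; pure bookkeeping).
* `SMLRSlot`             — the slit-monotone likelihood-ratio conjecture in the slot geometry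
                           (card `target-switching-smlr`, first checkable statement).
* `MirrorMonotone`       — TP₂ + lattice reflection ⇒ mirror monotonicity (card
                           `mirror-monotone-decay`, first lemma; follows from `BoundaryTP2`).
* `BubbleTailDive`       — the lattice-scale seed from `CriticalBubbleBound`.
-/

namespace Summit.CriticalPhenomena.SAWScalingLimit.Cruxes.TPToTraversalBound.Sketch

open scoped BigOperators ENNReal
open MeasureTheory Literature.Probability.LatticeModels
open Literature.Probability.RandomPlanarGeometry

noncomputable section

/-- The set of SAW chords `a → b` of `Ω_δ` that extend a given lattice prefix `η : a → v`. -/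
def PrefixSet (Ω : Set ℂ) (δ : ℝ) (a b : Site 2) {v : Site 2}
    (η : (discreteDomainGraph Ω δ).Walk a v) : Set (SAW.DomainSAW Ω δ a b) :=
  {γ | ∃ q : (discreteDomainGraph Ω δ).Walk v b, γ.walk = η.append q}

/-- **Optional stopping for the target-switching likelihood ratio** (bookkeeping lemma, provable
now). Let `S` be a finite family of prefixes from `a` whose extension events (for every target)
are pairwise disjoint (a "stopped" family), `J` a finite set of alternative targets and
`r : ℝ≥0∞`. If for every `η ∈ S` the unnormalised weight of `{extends η}` towards `J` is at least
`r` times that towards `b`, then `r · W_b(⋃ S) ≤ Z(a, J)`; dividing by `Z(a,b)`: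
`P_{a→b}(⋃ S) ≤ (Z(a,J)/Z(a,b)) / r`. -/
def OptionalStoppingLR : Prop :=
  ∀ (Ω : Set ℂ) (δ : ℝ) (a b : Site 2) (J : Finset (Site 2))
    (S : Finset (Σ v : Site 2, (discreteDomainGraph Ω δ).Walk a v)) (r : ℝ≥0∞),
    (∀ c : Site 2, (S : Set (Σ v : Site 2, (discreteDomainGraph Ω δ).Walk a v)).PairwiseDisjoint
        fun η => PrefixSet Ω δ a c η.2) →
    (∀ η ∈ S, r * SAW.weight Ω δ a b (PrefixSet Ω δ a b η.2)
        ≤ ∑ c ∈ J, SAW.weight Ω δ a c (PrefixSet Ω δ a c η.2)) →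
    r * SAW.weight Ω δ a b (⋃ η ∈ S, PrefixSet Ω δ a b η.2)
      ≤ ∑ c ∈ J, SAW.weight Ω δ a c Set.univ

/-- The slot domain at mesh `1`: an open box `(-L, L) × (0, L)` with a slot `(0, w) × (-D, 0]`
hanging below its bottom side (lattice sites: box rows `y = 1 … L-1`, slot columns
`x = 1 … w-1`, slot rows `y = -D+1 … 0`). -/
def slotDomain (L w D : ℕ) : Set ℂ :=
  {z | |z.re| < L ∧ 0 < z.im ∧ z.im < L} ∪ {z | 0 < z.re ∧ z.re < w ∧ -(D : ℝ) < z.im ∧ z.im ≤ 0}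

/-- **SMLR in the slot geometry** (conjecture; card `target-switching-smlr`). There is an aspect
ratio `C₀` such that in every slot domain with `D ≥ C₀ w`, for chords started at a bottom-row
site `a` left of the slot mouth, with far target `b` on the bottom row right of the mouth and deep
targets `J` = the bottom row of the slot, EVERY prefix `η` that has just completed the dive to
half depth (its tip is its only site at height `≤ -D/2`) is at least twice as likely under the
`J`-targeted chords as under the `b`-targeted chord:
`2 · W_b(ext η) · Z(a,J) ≤ W_J(ext η) · Z(a,b)` (all weights at `x_c`, mesh `1`). -/
def SMLRSlot : Prop :=
  ∃ C₀ : ℕ, 0 < C₀ ∧ ∀ (L w D : ℕ) (xa xb : ℤ), 2 ≤ w → C₀ * w ≤ D → (w : ℤ) + D ≤ L →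
    -(L : ℤ) < xa → xa ≤ 0 → (w : ℤ) ≤ xb → xb < L →
    let Ω := slotDomain L w D
    let a : Site 2 := ![xa, 1]
    let b : Site 2 := ![xb, 1]
    let J : Finset (Site 2) := (Finset.Icc (1 : ℤ) (w - 1)).image fun x => ![x, 1 - (D : ℤ)]
    ∀ (v : Site 2) (η : (discreteDomainGraph Ω 1).Walk a v),
      2 * v 1 ≤ -(D : ℤ) → (∀ u ∈ η.support, 2 * u 1 ≤ -(D : ℤ) → u = v) →
      2 * SAW.weight Ω 1 a b (PrefixSet Ω 1 a b η) * (∑ c ∈ J, SAW.weight Ω 1 a c Set.univ)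
        ≤ (∑ c ∈ J, SAW.weight Ω 1 a c (PrefixSet Ω 1 a c η)) * SAW.weight Ω 1 a b Set.univ

/-- Reflection of a site in the real axis, `(x, y) ↦ (x, -y)` (a `D₄` lattice symmetry). -/
def reflSite (v : Site 2) : Site 2 := ![v 0, -v 1]

/-- **Mirror monotonicity** (card `mirror-monotone-decay`, first lemma; a consequence of
`BoundaryTP2` + the reflection symmetry `z ↦ conj z` of the domain). In a bounded simply connected
domain symmetric under complex conjugation, for two lattice points `m, t` such that the quadruple
`(m, t, t̄, m̄)` satisfies the interlacing/realizability provisos of `BoundaryTP2` (chords `m–t̄`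
and `t–m̄` cross), the kernel does not grow under mirroring the target:
`Z(m, t̄) ≤ Z(m, t)`. Proof: TP₂ gives `Z(m,t̄) Z(t,m̄) ≤ Z(m,t) Z(t̄,m̄)`, and conjugation
symmetry gives `Z(t,m̄) = Z(m,t̄)`, `Z(t̄,m̄) = Z(m,t)`. -/
def MirrorMonotone : Prop :=
  Theses.SAWTotalPositivity.BoundaryTP2 →
  ∀ (Ω : Set ℂ) (δ : ℝ) (m t : Site 2), Bornology.IsBounded Ω → SimplyConnectedSpace Ω → 0 < δ →
    (starRingEnd ℂ) '' Ω = Ω →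
    (∀ (P : SAW.DomainSAW Ω δ m (reflSite t)) (Q : SAW.DomainSAW Ω δ t (reflSite m)),
        ∃ v, v ∈ P.walk.support ∧ v ∈ Q.walk.support) →
    (∃ (P : SAW.DomainSAW Ω δ m t) (Q : SAW.DomainSAW Ω δ (reflSite t) (reflSite m)),
        List.Disjoint P.walk.support Q.walk.support) →
    (∃ (P : SAW.DomainSAW Ω δ m (reflSite m)) (Q : SAW.DomainSAW Ω δ t (reflSite t)),
        List.Disjoint P.walk.support Q.walk.support) →
    SAW.weight Ω δ m (reflSite t) Set.univ ≤ SAW.weight Ω δ m t Set.univ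

/-- **Lattice-scale seed from the bubble** (provable now from `CriticalBubbleBound` + monotonicity
of the weight in the domain + vanishing tails of a convergent series): between ADJACENT lattice
points of any bounded domain, the critical chord makes an excursion of Euclidean size `≥ C δ` with
probability `≤ ε`, uniformly, once `C = C(ε)`. -/
def BubbleTailDive : Prop :=
  Theses.SAWTotalPositivity.CriticalBubbleBound →
  ∀ ε : ℝ, 0 < ε → ∃ C : ℕ, ∀ (Ω : Set ℂ) (δ : ℝ) (u v : Site 2), Bornology.IsBounded Ω → 0 < δ →
    (discreteDomainGraph Ω δ).Adj u v →
    SAW.law Ω δ u v {γ | ∃ z ∈ γ.walk.support, (C : ℝ) * δ ≤ dist (meshPoint δ z) (meshPoint δ u)}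
      ≤ ENNReal.ofReal ε

/-- **Power-law TP₂ in the slot geometry** (conjecture PTP; card `power-law-tp2`). The circular
TP₂ margin of the critical kernel grows without bound with the conformal modulus: for every `K`
there is an aspect ratio `C₀` such that in every slot domain with `D ≥ C₀ w`, for the boundary
quadruple `m` (bottom row of the box, left of the mouth), `p` (left slot column at depth `≥ D/2`),
`J` (slot bottom row), `b` (bottom row right of the mouth) — cyclic order `m, p, J, b`, so that the
pairing `(p,b)(m,J)` is the crossing one — one has `K · Z(p,b) · Z(m,J) ≤ Z(p,J) · Z(m,b)`.
`BoundaryTP2` is the case `K = 1`; in the continuum the ratio is a negative power of the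
cross-ratio. -/
def PTPSlot : Prop :=
  ∀ K : ℕ, ∃ C₀ : ℕ, 0 < C₀ ∧ ∀ (L w D : ℕ) (xa xb d : ℤ), 2 ≤ w → C₀ * w ≤ D → (w : ℤ) + D ≤ L →
    -(L : ℤ) < xa → xa ≤ 0 → (w : ℤ) ≤ xb → xb < L → (D : ℤ) ≤ 2 * d → d < D →
    let Ω := slotDomain L w D
    let m : Site 2 := ![xa, 1]
    let b : Site 2 := ![xb, 1]
    let p : Site 2 := ![1, -d]
    let J : Finset (Site 2) := (Finset.Icc (1 : ℤ) (w - 1)).image fun x => ![x, 1 - (D : ℤ)]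
    (K : ℝ≥0∞) * SAW.weight Ω 1 p b Set.univ * (∑ c ∈ J, SAW.weight Ω 1 m c Set.univ)
      ≤ (∑ c ∈ J, SAW.weight Ω 1 p c Set.univ) * SAW.weight Ω 1 m b Set.univ

/-- **Translation monotonicity of the half-plane boundary kernel** (card `mirror-monotone-decay`;
from TP₂ in large boxes + translation invariance, modulo the exhaustion `Ω ↑ ℍ`): along the
boundary row of the discrete upper half-plane box `(-L, L) × (0, L)` the kernel from the corner-free
point `0` is eventually non-increasing in the distance, uniformly: for `1 ≤ k ≤ k'` and all large
`L`, `Z_L(0, k') ≤ Z_L(0, k) + ε`. (Typed with an `ε` because at finite `L` translation invariance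
is only approximate.) -/
def TranslationMonotone : Prop :=
  Theses.SAWTotalPositivity.BoundaryTP2 →
  ∀ ε : ℝ, 0 < ε → ∀ k k' : ℕ, 1 ≤ k → k ≤ k' → ∃ L₀ : ℕ, ∀ L : ℕ, L₀ ≤ L →
    let Ω : Set ℂ := {z | |z.re| < L ∧ 0 < z.im ∧ z.im < L}
    SAW.weight Ω 1 ![0, 1] ![(k' : ℤ), 1] Set.univ
      ≤ SAW.weight Ω 1 ![0, 1] ![(k : ℤ), 1] Set.univ + ENNReal.ofReal ε

end

end Summit.CriticalPhenomena.SAWScalingLimit.Cruxes.TPToTraversalBound.Sketch
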